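import Literature.AlgebraicGeometry.HodgeTheory.CubicFourfoldHodgeConjectureChowZero
import Literature.Barriers.HodgeConjecture.DecompositionOfTheDiagonalDegreeFourHolds
import HarnessLib

/-!
# The Hodge conjecture for cubic fourfolds (Zucker 1977 / Murre 1977) — discharge of
# `hodgeTwoTwo_algebraic_cubicFourfold`

Family `hodge`, layer `Literature/AlgebraicGeometry/HodgeTheory`; theorems only (no definitions, no named
facts).

The named fact `Literature.AlgebraicGeometry.HodgeTheory.hodgeTwoTwo_algebraic_cubicFourfold`
(`CubicFourfoldHodgeConjecture.lean`: on a smooth cubic fourfold every rational `(2,2)`-class in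
`H⁴(X(ℂ); ℂ)` is algebraic — Zucker, Compositio Math. 34 (1977), (3.2) Theorem; Murre, Indag. Math. 80
(1977), Corollary p. 230) was reduced by `CubicFourfoldHodgeConjectureChowZero` to the SINGLE named fact
`Literature.Barriers.HodgeConjecture.BlochSrinivas1983_hodgeConjectureDegreeFour_of_chowZeroSupported`
(Bloch–Srinivas 1983 Thm. 1 (3) = Voisin II Prop. 10.26 in degree `4`: rational `(2,2)`-classes on a
smooth projective complex variety with `CH₀` supported in dimension `≤ 3` are algebraic), the `CH₀`
hypothesis for smooth cubic fourfolds being a theorem there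
(`hodgeTwoTwo_algebraic_cubicFourfold_of_blochSrinivas`; its module docstring: "the unconditional
discharge `hodgeTwoTwo_algebraic_cubicFourfold_holds` therefore awaits exactly
`BlochSrinivas1983_hodgeConjectureDegreeFour_of_chowZeroSupported_holds`").  That discharge has since
landed in the barrier layer (`DecompositionOfTheDiagonalDegreeFourHolds`, through the unconditional
Hodge-compatible Gysin formalism of the complex orientations), so the fact is now a theorem of the
Literature layer, by Murre's route exactly as printed (Voisin II, proof of Prop. 10.26, §10.2.3).

* `hodgeTwoTwo_algebraic_cubicFourfold_holds` — the discharge (net debt −1).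

(The summit layer proves the same statement independently, through the low-degree hypersurface
fourfold theorem `Summit.HodgeConjecture.….hypersurfaceHodgeFourLowDegree_proof`; the Literature layer
cannot import it, and this file closes the fact inside Literature.)

## References

* [Zucker1977] S. Zucker, The Hodge conjecture for cubic fourfolds, Compositio Math. 34 (1977)
  199–209, (3.2) Theorem.
* [Murre1977] J. P. Murre, On the Hodge conjecture for unirational fourfolds, Indag. Math. 80 (1977)
  230–232, Theorem and Corollary (p. 230).
* [BlochSrinivas1983] S. Bloch, V. Srinivas, Remarks on correspondences and algebraic cycles, Amer. J.
  Math. 105 (1983), Thm. 1 (3).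
* [VoisinHodgeII2003] C. Voisin, Hodge Theory and Complex Algebraic Geometry II, Prop. 10.26 and its
  proof (§10.2.3).
-/

noncomputable section

namespace Literature.AlgebraicGeometry.HodgeTheory

/-- **The Hodge conjecture for cubic fourfolds (Zucker 1977, (3.2) Theorem; Murre 1977, Corollary),
PROVED**: on a smooth cubic fourfold `X ⊂ ℙ⁵_ℂ` every rational class of Hodge type `(2,2)` in
`H⁴(X(ℂ); ℂ)` lies in `algebraicClasses X 2` — Murre's route: Bloch–Srinivas / Voisin II Prop. 10.26
in degree `4` (`BlochSrinivas1983_hodgeConjectureDegreeFour_of_chowZeroSupported_holds`) applied to the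
`CH₀`-support of smooth cubic fourfolds (`hodgeTwoTwo_algebraic_cubicFourfold_of_blochSrinivas`).
[cite: Zucker1977, (3.2) Theorem, p. 205] [cite: Murre1977, Theorem and Corollary, p. 230]
[cite: VoisinHodgeII2003, Prop. 10.26 and its proof] -/
theorem hodgeTwoTwo_algebraic_cubicFourfold_holds : hodgeTwoTwo_algebraic_cubicFourfold :=
  hodgeTwoTwo_algebraic_cubicFourfold_of_blochSrinivas
    Literature.Barriers.HodgeConjecture.BlochSrinivas1983_hodgeConjectureDegreeFour_of_chowZeroSupported_holds

end Literature.AlgebraicGeometry.HodgeTheory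

end
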